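import Mathlib.Data.Finite.Sum
import Literature.AnabelianGeometry.SemiGraphs.SubdivisionLemmas
import Literature.AnabelianGeometry.SemiGraphs.SemiGraphBranches
import Literature.AnabelianGeometry.SemiGraphs.OrbitGraphFinite

/-!
# Counting the barycentric subdivision: a finite semi-graph is a tree iff it is connected and `#(abutting branches) + 1 = #vertices + #edges` ([SemiAnbd] §1 p.13)

Mochizuki, *Semi-graphs of anabelioids*, Publ. RIMS **42** (2006), §1 pp.11–13: the topological space
of a semi-graph; "tree" = contractible (kurims `paper:url-f33ace170ff4`); rendered in `SemiGraph.lean`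
as: the barycentric subdivision (a simple graph on vertices ⊔ edges ⊔ branches) is a tree.
[cite: MochizukiSemiAnbd2006, §1, p. 13]

PROOF-ONLY Euler-characteristic bookkeeping for the L3 merge dictionary (`IsFiniteTree` of the §§4–5
container vs `SemiGraph.IsTree`) and reusable elsewhere:

* `natCard_branch` — a finite semi-graph has `2 · #edges` branches;
* `natCard_edgeSet_subdivision` — the subdivision has `#branches + #(abutting branches)` edges
  (each branch is joined to the midpoint of its edge, and to the vertex it abuts to, if any);
* `natCard_node` — it has `#vertices + #edges + #branches` nodes;
* `isTree_iff_isConnected_and_card` — for FINITE `G`: `G.IsTree ↔ G.IsConnected ∧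
  #{b | ζ(b) ≠ 𝒱} + 1 = #vertices + #edges` (Mathlib's `SimpleGraph.isTree_iff_connected_and_card`
  on the subdivision).

No definitions (the counting bijection is a local function inside the proof); `SemiGraph.finite_branch`
is reused from `OrbitGraphFinite.lean`.
-/

namespace Literature.AnabelianGeometry.SemiGraphs

namespace SemiGraph

open CategoryTheory

universe u

variable (G : SemiGraph.{u})

/-- **A finite semi-graph has `2 · #edges` branches** (§1 (2): every edge is a set of cardinality 2).
[cite: MochizukiSemiAnbd2006, §1, p. 11] -/
theorem natCard_branch [Finite G.Edge] : Nat.card G.Branch = 2 * Nat.card G.Edge := by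
  haveI := Fintype.ofFinite G.Edge
  haveI : ∀ e : G.Edge, Finite (G.branchesOf e) := fun e =>
    Nat.finite_of_card_ne_zero (by rw [G.natCard_branchesOf e]; decide)
  rw [← Nat.card_congr (Equiv.sigmaFiberEquiv G.edgeOf), Nat.card_sigma]
  simp only [natCard_branchesOf, Finset.sum_const, Finset.card_univ, smul_eq_mul,
    Nat.card_eq_fintype_card]
  omega

/-- The nodes of the subdivision of a finite semi-graph: `#vertices + (#edges + #branches)`.
[cite: MochizukiSemiAnbd2006, §1, p. 12] -/
theorem natCard_node [Finite G.Vertex] [Finite G.Edge] :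
    Nat.card G.Node = Nat.card G.Vertex + (Nat.card G.Edge + Nat.card G.Branch) := by
  haveI := G.finite_branch
  rw [Nat.card_sum, Nat.card_sum]

/-- **The edges of the barycentric subdivision**: one for each branch (to the midpoint of its edge) and
one for each abutting branch (to the vertex it abuts to): for a finite semi-graph,
`#edgeSet = #branches + #{b | ζ(b) ≠ 𝒱}`. [cite: MochizukiSemiAnbd2006, §1, p. 12] -/
theorem natCard_edgeSet_subdivision [Finite G.Vertex] [Finite G.Edge] :
    Nat.card G.subdivision.edgeSet =
      Nat.card G.Branch + Nat.card {b : G.Branch // (G.abuts b).isSome} := by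
  haveI := G.finite_branch
  -- the counting map
  let f : G.Branch ⊕ {b : G.Branch // (G.abuts b).isSome} → G.subdivision.edgeSet := fun x =>
    match x with
    | .inl b => ⟨s(Sum.inr (Sum.inl (G.edgeOf b)), Sum.inr (Sum.inr b)),
        (SimpleGraph.mem_edgeSet _).mpr (G.subdivision_adj_of_nodeRel (NodeRel.edge_branch b))⟩
    | .inr b => ⟨s(Sum.inr (Sum.inr b.1), Sum.inl ((G.abuts b.1).get b.2)),
        (SimpleGraph.mem_edgeSet _).mpr (G.subdivision_adj_of_nodeRel
          (NodeRel.branch_vertex b.1 _ (Option.some_get b.2).symm))⟩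
  have hf : Function.Bijective f := by
    constructor
    · rintro (b | ⟨b, hb⟩) (c | ⟨c, hc⟩) h <;>
        have h' := congrArg Subtype.val h <;> simp only [f] at h' <;> rw [Sym2.eq_iff] at h' <;>
        rcases h' with ⟨h1, h2⟩ | ⟨h1, h2⟩ <;> simp_all
    · rintro ⟨e, he⟩
      induction e using Sym2.ind with
      | h x y =>
        rw [SimpleGraph.mem_edgeSet, subdivision_adj_iff, nodeRel_iff, nodeRel_iff] at he
        rcases he with (⟨b, rfl, rfl⟩ | ⟨b, v, hb, rfl, rfl⟩) | (⟨b, rfl, rfl⟩ | ⟨b, v, hb, rfl, rfl⟩)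
        · exact ⟨.inl b, rfl⟩
        · refine ⟨.inr ⟨b, by rw [hb]; rfl⟩, Subtype.ext ?_⟩
          have hv : (G.abuts b).get (by rw [hb]; rfl) = v := by simp only [hb, Option.get_some]
          simp only [f, hv]
        · exact ⟨.inl b, Subtype.ext Sym2.eq_swap⟩
        · refine ⟨.inr ⟨b, by rw [hb]; rfl⟩, Subtype.ext ?_⟩
          have hv : (G.abuts b).get (by rw [hb]; rfl) = v := by simp only [hb, Option.get_some]
          simp only [f, hv]
          exact Sym2.eq_swap
  rw [← Nat.card_eq_of_bijective f hf, Nat.card_sum]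

/-- **Tree criterion by counting** (finite Euler characteristic of the barycentric subdivision): a
FINITE semi-graph is a tree iff it is connected and `#{b | ζ(b) ≠ 𝒱} + 1 = #vertices + #edges`.
[cite: MochizukiSemiAnbd2006, §1, p. 13] -/
theorem isTree_iff_isConnected_and_card (hfin : G.IsFinite) :
    G.IsTree ↔ G.IsConnected ∧
      Nat.card {b : G.Branch // (G.abuts b).isSome} + 1 = Nat.card G.Vertex + Nat.card G.Edge := by
  haveI := hfin.finite_vertex
  haveI := hfin.finite_edge
  haveI := G.finite_branch
  rw [isTree_iff, isConnected_iff, SimpleGraph.isTree_iff_connected_and_card,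
    G.natCard_edgeSet_subdivision, G.natCard_node, G.natCard_branch]
  constructor
  · rintro ⟨hc, h⟩
    exact ⟨hc, by omega⟩
  · rintro ⟨hc, h⟩
    exact ⟨hc, by omega⟩

end SemiGraph

end Literature.AnabelianGeometry.SemiGraphs
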